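import Mathlib

/-!
# CRIT-1 g5 probe for IDEA-3 g12 `HellingerRoadSketch.lean` EDITION 3 (9a3cb4ec16d8719f) — rider R2 «TAME CONDITIONING»

Finding (sheet `CRIT-1-TRIAGE-hellinger-free-energy-road-ed3.md`): in ed.3's one-`(K,t)` kernel
`one_sub_bc_classLaw_le_wild_add_tilts` and in `hellingerRate_of_tilts` the analytic-tilt letter is stated for the FULL class laws
(tilt by `h = log B − log A` summed over ALL of `T`, wild classes included); the wild set `W` occurs in no hypothesis but `W ⊆ T`, so the
wild-mass term of the conclusion is IDLE (the `W = ∅` instance is stronger), and the full-law tilt letter at radius `r₀∕η_K` is not what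
(KR)+(V‑b) supply (on over-aged components the increment is `O(p₀)`, not `O(η_K·size)`).

REPAIR, certified below [folklore]: CONDITION ON TAME first —
`1 − bc(p,q) ≤ max(p(W), q(W)) + (1 − bc(p|tame, q|tame))`, `p|tame := p∕p(T∖W)` on `T∖W` —
then apply ed.3's kernel with `W := ∅` to the tame-RESTRICTED weights `A|_{T∖W}, B|_{T∖W}`, whose tilted class sums ARE `cZ` over the
non-over-aged polymers (`tilt_classSum_eq_cZ` on `Λ∖(over-aged)`), where (KR)+(V‑b) hold.  No new letter enters the bill.

`bc` is a verbatim copy of the kernel's :92.  Honest framing: elementary real analysis; nothing of Bałaban's is asserted or proved; K0⁷–K3⁷ open;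
R4 = the conditional finite‑𝕋⁴ rung `BalabanLadder.UV` only; the Yang–Mills mass gap (Clay) is NOT proved by any of this.
-/

namespace Summit.QuantumFields.YangMills.Cruxes.SpineGivenEndpointR13SepCoPH.HellingerRoadCrit1

open Finset

variable {ι : Type*}

/-- verbatim copy of `YMNodeOIdeate.Idea3.HellingerRoad.bc` (kernel :92). -/
noncomputable def bc (T : Finset ι) (p q : ι → ℝ) : ℝ := ∑ τ ∈ T, Real.sqrt (p τ * q τ)

theorem bc_nonneg (T : Finset ι) (p q : ι → ℝ) : 0 ≤ bc T p q :=
  sum_nonneg fun _ _ => Real.sqrt_nonneg _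

/-- `√(xy) ≤ (x+y)/2` for `0 ≤ x, y` [folklore]. -/
theorem sqrt_mul_le_add_half {x y : ℝ} (hx : 0 ≤ x) (hy : 0 ≤ y) : Real.sqrt (x * y) ≤ (x + y) / 2 := by
  have h : x * y ≤ ((x + y) / 2) ^ 2 := by nlinarith [sq_nonneg (x - y)]
  calc Real.sqrt (x * y) ≤ Real.sqrt (((x + y) / 2) ^ 2) := Real.sqrt_le_sqrt h
    _ = (x + y) / 2 := Real.sqrt_sq (by positivity)

/-- The affinity of two (sub-)probability vectors is at most the mean of their masses; in particular `≤ 1` for laws. -/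
theorem bc_le_half_mass (T : Finset ι) {p q : ι → ℝ} (hp : ∀ τ ∈ T, 0 ≤ p τ) (hq : ∀ τ ∈ T, 0 ≤ q τ) :
    bc T p q ≤ ((∑ τ ∈ T, p τ) + ∑ τ ∈ T, q τ) / 2 := by
  unfold bc
  calc ∑ τ ∈ T, Real.sqrt (p τ * q τ) ≤ ∑ τ ∈ T, (p τ + q τ) / 2 :=
        sum_le_sum fun τ hτ => sqrt_mul_le_add_half (hp τ hτ) (hq τ hτ)
    _ = ((∑ τ ∈ T, p τ) + ∑ τ ∈ T, q τ) / 2 := by rw [← sum_div, sum_add_distrib]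

/-- **TAME CONDITIONING** [folklore]: for two laws `p, q` on `T` and a wild set `W ⊆ T` with positive tame masses,
`1 − bc(p,q) ≤ max(p(W), q(W)) + (1 − bc_{T∖W}(p∕p(T∖W), q∕q(T∖W)))`.
So the Hellinger letter splits into WILD MASS plus the Hellinger distance of the TAME-CONDITIONED laws — and only the latter needs tilts. -/
theorem one_sub_bc_le_wildMass_add_tame [DecidableEq ι] {T W : Finset ι} {p q : ι → ℝ} (hW : W ⊆ T)
    (hp : ∀ τ ∈ T, 0 ≤ p τ) (hq : ∀ τ ∈ T, 0 ≤ q τ)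
    (hp1 : ∑ τ ∈ T, p τ = 1) (hq1 : ∑ τ ∈ T, q τ = 1)
    (hP : 0 < ∑ τ ∈ T \ W, p τ) (hQ : 0 < ∑ τ ∈ T \ W, q τ) :
    1 - bc T p q ≤ max (∑ τ ∈ W, p τ) (∑ τ ∈ W, q τ)
      + (1 - bc (T \ W) (fun τ => p τ / ∑ σ ∈ T \ W, p σ) (fun τ => q τ / ∑ σ ∈ T \ W, q σ)) := by
  set P := ∑ τ ∈ T \ W, p τ with hPdef
  set Q := ∑ τ ∈ T \ W, q τ with hQdef
  set m := max (∑ τ ∈ W, p τ) (∑ τ ∈ W, q τ) with hmdef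
  set b' := bc (T \ W) (fun τ => p τ / P) (fun τ => q τ / Q) with hb'def
  -- masses: P = 1 − p(W), Q = 1 − q(W)
  have hPW : P + ∑ τ ∈ W, p τ = 1 := by rw [hPdef, sum_sdiff hW]; exact hp1
  have hQW : Q + ∑ τ ∈ W, q τ = 1 := by rw [hQdef, sum_sdiff hW]; exact hq1
  have hP1m : 1 - m ≤ P := by have := le_max_left (∑ τ ∈ W, p τ) (∑ τ ∈ W, q τ); linarith
  have hQ1m : 1 - m ≤ Q := by have := le_max_right (∑ τ ∈ W, p τ) (∑ τ ∈ W, q τ); linarith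
  have hm0 : 0 ≤ m := le_trans (sum_nonneg fun τ hτ => hp τ (hW hτ)) (le_max_left _ _)
  -- the tame part of the affinity is √(PQ)·b'
  have hsdp : ∀ τ ∈ T \ W, 0 ≤ p τ := fun τ hτ => hp τ (sdiff_subset hτ)
  have hsdq : ∀ τ ∈ T \ W, 0 ≤ q τ := fun τ hτ => hq τ (sdiff_subset hτ)
  have hPQ : 0 < P * Q := mul_pos hP hQ
  have hb'eq : b' = (∑ τ ∈ T \ W, Real.sqrt (p τ * q τ)) / Real.sqrt (P * Q) := by
    rw [hb'def, bc, sum_div]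
    refine sum_congr rfl fun τ _ => ?_
    rw [div_mul_div_comm, Real.sqrt_div' _ hPQ.le]
  have hS : ∑ τ ∈ T \ W, Real.sqrt (p τ * q τ) = b' * Real.sqrt (P * Q) := by
    rw [hb'eq, div_mul_cancel₀ _ (Real.sqrt_pos.2 hPQ).ne']
  have hsplit : bc T p q = ∑ τ ∈ T \ W, Real.sqrt (p τ * q τ) + ∑ τ ∈ W, Real.sqrt (p τ * q τ) := by
    rw [bc, sum_sdiff hW]
  have hWnn : 0 ≤ ∑ τ ∈ W, Real.sqrt (p τ * q τ) := sum_nonneg fun _ _ => Real.sqrt_nonneg _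
  have hb'0 : 0 ≤ b' := bc_nonneg _ _ _
  -- b' ≤ 1 (affinity of two laws)
  have hb'1 : b' ≤ 1 := by
    have h := bc_le_half_mass (T \ W) (p := fun τ => p τ / P) (q := fun τ => q τ / Q)
      (fun τ hτ => div_nonneg (hsdp τ hτ) hP.le) (fun τ hτ => div_nonneg (hsdq τ hτ) hQ.le)
    have e1 : ∑ τ ∈ T \ W, p τ / P = 1 := by rw [← sum_div, div_self hP.ne']
    have e2 : ∑ τ ∈ T \ W, q τ / Q = 1 := by rw [← sum_div, div_self hQ.ne']
    rw [e1, e2] at h; rw [hb'def]; linarith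
  -- case split on the sign of 1 − m
  rcases le_or_gt m 1 with hm1 | hm1
  · -- √(PQ) ≥ 1 − m ≥ 0
    have hsq : 1 - m ≤ Real.sqrt (P * Q) := by
      have hmul : (1 - m) * (1 - m) ≤ P * Q := mul_le_mul hP1m hQ1m (by linarith) hP.le
      calc 1 - m = Real.sqrt ((1 - m) ^ 2) := (Real.sqrt_sq (by linarith)).symm
        _ ≤ Real.sqrt (P * Q) := Real.sqrt_le_sqrt (by nlinarith [hmul])
    have h1 : b' * (1 - m) ≤ bc T p q := by
      rw [hsplit, hS]
      have := mul_le_mul_of_nonneg_left hsq hb'0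
      linarith
    nlinarith [h1, hb'1, hm0]
  · have : bc T p q ≥ 0 := bc_nonneg _ _ _
    linarith

end Summit.QuantumFields.YangMills.Cruxes.SpineGivenEndpointR13SepCoPH.HellingerRoadCrit1
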